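import Literature.AnabelianGeometry.EtaleTheta.GalSectThm110iii
import Literature.AnabelianGeometry.EtaleTheta.Discharge.Sec1Def17Coverings
import HarnessLib

/-!
# A CUSP BELOW A `DotCCusp` SPLITS IN `Ẋ` — the decomposition-group criterion of [EtTh] Thm. 1.10 (iii)'s cusp datum

S. Mochizuki, *The étale theta function …*, Publ. RIMS **45** (2009) [EtTh], Def. 1.7 p. 27 ("`Ẍ^log → X^log` …
the Galois covering of degree 4 determined by the multiplication by 2 map", "`Ẋ^log` … the quotient by the action of
`ε_Z`", "`Ċ^log`"), Thm. 1.10 (iii) p. 30 (the torsor "at the unique cusp of `Ċ^log`") [cite: MochizukiEtTh2009, Def 1.7 p.27];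
S. Mochizuki, *Galois sections …* [GalSect], §4 p. 33 [cite: MochizukiGalSect2005, §4 p.33].

abc-iut cell, layer L2, seat abc-iut-w5-d029 (gen 5); L2-lead R226 (b1) «DotCCusp / cusp-pair producers at the cusped χ-model
modelχ′».  PROOF-ONLY (0 definitions, 0 instances).

(A) GENERIC (any `M : MuTwoSetting p`, any admissible `ε_Z`).  abc-iut-w5-d062's data `M.DotCCusp εZ`
(`GalSectThm110iii`) / `M.DotCCuspTorsor εZ` (`GalSectIntegralStructures`) carry `D ≤ Π^tp_Ċ` and
`D ∩ Π^tp_X = g·D_x·g⁻¹` for a cusp `x` of `X`.  With abc-iut's `dotC_inf_range` (`Π^tp_Ċ ∩ Π^tp_X = Π^tp_Ẋ`,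
`Sec1Def17Coverings`) this forces **`g·D_x·g⁻¹ ≤ Π^tp_Ẋ = Π^tp_Ẍ ∪ Π^tp_Ẍ·ε_Z`**, and since `Π^tp_X/Π^tp_Ẍ` is an
elementary abelian `2`-group the conjugation drops out: **every `d ∈ D_x` satisfies `d ∈ Π^tp_Ẍ` or `d·z⁻¹ ∈ Π^tp_Ẍ`**
(`ε_Z = inclX z`) — the cusp `x` SPLITS in `Ẋ → X` (as it does in print: `Ẍ → X` is étale over the cusp and `K = K̈`, so
`D_x ≤ Π^tp_Ẍ`).  `DotCCusp.map_conj_decomp_le_dotX`, `DotCCusp.mem_GtpXdd_or_of_mem_decomp`, and the `DotCCuspTorsor`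
twins.

(B) (companion file `GalSectDotCCuspDecompCriterionModels`, filed once the oleans of this seat's cusped Def. 1.7 records
`MuTwoSetting.modelχ′` / `MuTwoSetting.modelχq′` are on the hub): at the Tate-twisted `b`-axis cusp models the criterion FAILS
(`b ∈ D_x` has parity `(0,1) = parity(ε_μ)`, an admissible `ε_Z` has parity `∉ {0, parity(ε_μ)}`), so `DotCCusp` /
`DotCCuspTorsor` are EMPTY there for every admissible `ε_Z` — R226 (b1) needs a commutator-axis cusp at a Kummer-carrying model.

HONEST LABEL: elementary group theory over the typed interfaces; nothing of [EtTh]/[GalSect] asserted; no side taken on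
[IUTchIII] Cor. 3.12; typed ≠ proved.
-/

noncomputable section

namespace Literature.AnabelianGeometry.EtaleTheta.MuTwoSetting

open Literature.AnabelianGeometry.SemiGraphs
open scoped Pointwise

variable {p : ℕ} [Fact p.Prime] (M : MuTwoSetting p) {εZ : M.GtpC}

/-! ### (A) The criterion: the cusp below splits in `Ẋ` -/

/-- In `Π^tp_X/Π^tp_Ẍ` (all squares die) cosets are conjugation-invariant: `c·d·c⁻¹·w ∈ Π^tp_Ẍ ↔ d·w ∈ Π^tp_Ẍ`.
[cite: MochizukiEtTh2009, Def 1.7 p.27] -/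
theorem conj_mul_mem_GtpXdd_iff (c d w : M.PiTemp) : c * d * c⁻¹ * w ∈ M.GtpXdd ↔ d * w ∈ M.GtpXdd := by
  haveI := M.GtpXdd_normal
  have hsq : ∀ g : M.PiTemp, ((g : M.PiTemp ⧸ M.GtpXdd) : M.PiTemp ⧸ M.GtpXdd) * g = 1 := fun g => by
    rw [← QuotientGroup.mk_mul, QuotientGroup.eq_one_iff]
    exact M.mul_self_mem_GtpXdd g
  have hinv : ∀ a : M.PiTemp ⧸ M.GtpXdd, a⁻¹ = a := fun a => by
    obtain ⟨x, rfl⟩ := QuotientGroup.mk_surjective a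
    rw [inv_eq_iff_mul_eq_one]
    exact hsq x
  have hcomm : ∀ a b : M.PiTemp ⧸ M.GtpXdd, a * b = b * a := fun a b => by
    calc a * b = (a * b)⁻¹ := (hinv _).symm
      _ = b⁻¹ * a⁻¹ := mul_inv_rev a b
      _ = b * a := by rw [hinv, hinv]
  rw [← QuotientGroup.eq_one_iff, ← QuotientGroup.eq_one_iff (N := M.GtpXdd) (d * w)]
  simp only [QuotientGroup.mk_mul, QuotientGroup.mk_inv]
  rw [hcomm (c : M.PiTemp ⧸ M.GtpXdd) (d : M.PiTemp ⧸ M.GtpXdd), mul_inv_cancel_right]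

namespace DotCCusp

variable {M}

/-- `g·D_x·g⁻¹ ≤ Π^tp_Ċ ∩ Π^tp_X` for the cusp below a `DotCCusp`. [cite: MochizukiEtTh2009, Thm 1.10 (iii) p.30] -/
theorem map_conj_decomp_le (C : M.DotCCusp εZ) :
    (MulAut.conj C.conj • M.decomp C.cusp).map M.inclX ≤ M.dotC εZ ⊓ M.inclX.range := by
  rw [← C.D_inf_range]
  exact inf_le_inf_right _ C.D_le

/-- **`g·D_x·g⁻¹ ≤ Π^tp_Ẋ`** (admissible `ε_Z`; `Π^tp_Ċ ∩ Π^tp_X = Π^tp_Ẋ`). [cite: MochizukiEtTh2009, Def 1.7 p.27] -/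
theorem map_conj_decomp_le_dotX (C : M.DotCCusp εZ) (hZ : M.IsAdmissibleEpsZ εZ) :
    (MulAut.conj C.conj • M.decomp C.cusp).map M.inclX ≤ M.dotX εZ := by
  rw [← M.dotC_inf_range hZ]
  exact C.map_conj_decomp_le

/-- **The cusp below a `DotCCusp` splits in `Ẋ`**: every `d ∈ D_x` lies in `Π^tp_Ẍ` or in `Π^tp_Ẍ·ε_Z`
(`ε_Z = inclX z`). [cite: MochizukiEtTh2009, Def 1.7 p.27] -/
theorem mem_GtpXdd_or_of_mem_decomp (C : M.DotCCusp εZ) (hZ : M.IsAdmissibleEpsZ εZ) {z : M.PiTemp}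
    (hz : M.inclX z = εZ) {d : M.PiTemp} (hd : d ∈ M.decomp C.cusp) : d ∈ M.GtpXdd ∨ d * z⁻¹ ∈ M.GtpXdd := by
  have hmem : M.inclX (C.conj * d * C.conj⁻¹) ∈ M.dotX εZ := by
    refine C.map_conj_decomp_le_dotX hZ ⟨C.conj * d * C.conj⁻¹, ?_, rfl⟩
    exact Subgroup.mem_pointwise_smul_iff_inv_smul_mem.mpr (by simpa [MulAut.smul_def, mul_assoc] using hd)
  rcases (M.mem_dotX_iff εZ _).mp hmem with h | h
  · left
    have h' : C.conj * d * C.conj⁻¹ * 1 ∈ M.GtpXdd := by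
      rw [mul_one]; exact (Subgroup.mem_map_iff_mem M.injective_inclX).mp h
    simpa using (M.conj_mul_mem_GtpXdd_iff C.conj d 1).mp h'
  · right
    have h' : M.inclX (C.conj * d * C.conj⁻¹ * z⁻¹) ∈ M.GtpXdd.map M.inclX := by
      rw [map_mul, map_inv, hz]; exact h
    rw [Subgroup.mem_map_iff_mem M.injective_inclX] at h'
    exact (M.conj_mul_mem_GtpXdd_iff C.conj d z⁻¹).mp h'

end DotCCusp

namespace DotCCuspTorsor

variable {M}

/-- `g·D_x·g⁻¹ ≤ Π^tp_Ċ ∩ Π^tp_X` for the cusp below a `DotCCuspTorsor`. [cite: MochizukiEtTh2009, Thm 1.10 (iii) p.30] -/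
theorem map_conj_decomp_le (C : M.DotCCuspTorsor εZ) :
    (MulAut.conj C.conj • M.decomp C.cusp).map M.inclX ≤ M.dotC εZ ⊓ M.inclX.range := by
  rw [← C.Dc_inf_range]
  exact inf_le_inf_right _ C.Dc_le

/-- `g·D_x·g⁻¹ ≤ Π^tp_Ẋ` for a `DotCCuspTorsor` (admissible `ε_Z`). [cite: MochizukiEtTh2009, Def 1.7 p.27] -/
theorem map_conj_decomp_le_dotX (C : M.DotCCuspTorsor εZ) (hZ : M.IsAdmissibleEpsZ εZ) :
    (MulAut.conj C.conj • M.decomp C.cusp).map M.inclX ≤ M.dotX εZ := by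
  rw [← M.dotC_inf_range hZ]
  exact C.map_conj_decomp_le

/-- The cusp below a `DotCCuspTorsor` splits in `Ẋ`. [cite: MochizukiEtTh2009, Def 1.7 p.27] -/
theorem mem_GtpXdd_or_of_mem_decomp (C : M.DotCCuspTorsor εZ) (hZ : M.IsAdmissibleEpsZ εZ) {z : M.PiTemp}
    (hz : M.inclX z = εZ) {d : M.PiTemp} (hd : d ∈ M.decomp C.cusp) : d ∈ M.GtpXdd ∨ d * z⁻¹ ∈ M.GtpXdd := by
  have hmem : M.inclX (C.conj * d * C.conj⁻¹) ∈ M.dotX εZ := by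
    refine C.map_conj_decomp_le_dotX hZ ⟨C.conj * d * C.conj⁻¹, ?_, rfl⟩
    exact Subgroup.mem_pointwise_smul_iff_inv_smul_mem.mpr (by simpa [MulAut.smul_def, mul_assoc] using hd)
  rcases (M.mem_dotX_iff εZ _).mp hmem with h | h
  · left
    have h' : C.conj * d * C.conj⁻¹ * 1 ∈ M.GtpXdd := by
      rw [mul_one]; exact (Subgroup.mem_map_iff_mem M.injective_inclX).mp h
    simpa using (M.conj_mul_mem_GtpXdd_iff C.conj d 1).mp h'
  · right
    have h' : M.inclX (C.conj * d * C.conj⁻¹ * z⁻¹) ∈ M.GtpXdd.map M.inclX := by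
      rw [map_mul, map_inv, hz]; exact h
    rw [Subgroup.mem_map_iff_mem M.injective_inclX] at h'
    exact (M.conj_mul_mem_GtpXdd_iff C.conj d z⁻¹).mp h'

end DotCCuspTorsor

end Literature.AnabelianGeometry.EtaleTheta.MuTwoSetting

end
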